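import Mathlib
import HarnessLib
import Summits.RiemannHypothesis.RiemannHypothesis.Theses.DeBrangesSuzukiDoor
import Summits.RiemannHypothesis.RiemannHypothesis.Theorems.DeBrangesSuzukiDoorKernelSupport
import Summits.RiemannHypothesis.RiemannHypothesis.Theorems.DeBrangesSuzukiDoorKernelLaplaceIdentity
import Summits.RiemannHypothesis.RiemannHypothesis.Theorems.DeBrangesSuzukiDoorDoorModuloKernel

/-!
# RiemannHypothesis / DeBrangesSuzukiDoor — the rung leaf `WitnessDetectsRH` (stmt-RiemannHypothesis-19730) PROVED

THE RUNG LEAF B-P of route `route-RiemannHypothesis-DeBrangesSuzukiDoor`, hypothesis-free form: for every `θ > 10`,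
`W_θ ∈ L²(ℝ) ⟹ RH`, where `W_θ(x) = ∫₀¹ K_θ(x+y) dy` is the window average of Suzuki's single kernel. Derived exactly
as in the first line of the route's `closes`: `DoorModuloKernel` (`doorModuloKernel_proof`, p410258) fed with the two
proved cruxes `KernelSupport` (`kernelSupport_proof`, p408794) and `KernelLaplaceIdentity`
(`kernelLaplaceIdentity_proof`, p408796). An RH-FREE theorem about an RH-EQUIVALENT·DERIVED criterion (under RH,
`‖W_θ‖₂ = 1`); with it the route stands CLOSED MODULO its declared residual `DoorWitness`. Nothing here bears on the
truth of RH.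
-/

noncomputable section

-- D-0017: `Summit.<S>.<S>.…` is the designed namespace of a single-problem summit.
set_option linter.dupNamespace false

namespace Summit.RiemannHypothesis.RiemannHypothesis.Theorems

/-- **Route `DeBrangesSuzukiDoor`, rung leaf `WitnessDetectsRH` (stmt-RiemannHypothesis-19730) — PROVED (RH-FREE).**
For every `θ > 10`: if the window average `W_θ` of Suzuki's kernel `K_θ` is in `L²(ℝ)`, then the Riemann
Hypothesis holds. -/
theorem witnessDetectsRH_proof : Theses.DeBrangesSuzukiDoor.WitnessDetectsRH := by
  intro θ hθ Θ K hMem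
  exact doorModuloKernel_proof θ hθ (kernelSupport_proof θ hθ) (kernelLaplaceIdentity_proof θ hθ) hMem

end Summit.RiemannHypothesis.RiemannHypothesis.Theorems

end
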